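import Summits.ResolutionOfSingularities.ResolutionOfSingularities.Theorems.HilbertSamuelEliminationCampaignW42NormalConeRidgePoint
import Literature.RingTheory.HilbertSamuel.HironakaGrothendieckIsomorphism
import HarnessLib

/-!
# [OURS · L1 W4.2] CJS Thm. 3.14 for an ARBITRARY permissible centre in the regime `e_x(X) = ē_x(X)` — numerical form
# `dim 𝒪_{D,x} < e_x(X)` AND the normal-directrix form `𝒯(C_{X,D,x}) ⊆ 𝔭_{x'}` — every characteristic, no characteristic
# hypothesis, NO named fact (campaign s42, cell res-hironaka; informal crux `RidgeConfinement`,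
# stmt-ResolutionOfSingularities-17845 «CJS Thm 3.14 … in EVERY characteristic»; consumers in chain w42, 19249; `--supports`)

HONEST FRAMING. OURS (slot W4.2, prover res-L1-s42-pv-1, gen 4). res-type-001's `theorem314_geomDir_of_facts`
(`…Corridor3Directrix214SharpCentre`, p516811) proves the numerical 2.14♯ — a near point `x'` over `x ∈ D` forces
`dim 𝒪_{D,x} < e_x(X)` — under (F1♯) `char κ(x) = 0 ∨ ē_x(X) + 2 ≤ 2·char κ(x)` MODULO the printed facts F-51′ (Hironaka
1970 Th. IV), F-52, F-50b (Mizutani), F-split and CJS 3.14; its core is `𝒯(J_D) ⊆ 𝔭_{x'}` (every linear form of the directrix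
of the fibre `C_{X,D,x}` of the normal cone vanishes at the point `x'` of `ℙ(C_{X,D,x})`). This file proves the SAME
conclusions with (F1♯) replaced by CJS's (F3) `e_x(X) = ē_x(X)`, with NO binder and WITHOUT `dim X ≤ N`:

* **`directrixSpace_normalConeIdeal_le_chartPrime_of_dirDim_eq_geomDirDim`** — for `X` excellent, `D` permissible, `π` a
  blow-up in `D`, `x'` near over `x ∈ D` with `e_x(X) = ē_x(X)`: `𝒯(J_D) ⊆ 𝔭_{x'}` — i.e. `x' ∈ ℙ(Dir_x(X)/T_x(D))` read on the
  linear equations of the normal directrix (F-split = Hironaka–Grothendieck, now the tree THEOREM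
  `HerrmannIkedaOrbanz1988_cor_21_11_holds`, transports `e = ē` from `C_x(X)` to `C_{X,D,x}` through `e(J·k[X,Y]) = e(J) + s`;
  then `𝒯(J_D) ⊆ √𝔉(J_D)` (`directrixSpace_le_radical_ridgeIdeal_of_directrixDim_map_eq`, p518570) and `ū ∈ F(J_D)(κ(x'))`
  (`residue_mem_ridge_normalConeIdeal_of_isNearPoint`, `…CampaignW42NormalConeRidgePoint`));
* **`theorem314_numerical_of_dirDim_eq_geomDirDim`** — hence `dim 𝒪_{D,x} < e_x(X)` (res-type-001's counting verbatim).

So in the (F3) regime the W4.2 binder `Moving.Theorem314_geomDir` needs neither F-51′ nor (F1♯). NOTHING here is a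
statement of H. Hironaka's manuscript [Hironaka2017]. AI review is weaker than expert review. References (orientation only):
V. Cossart, U. Jannsen, S. Saito, LNM 2270 (2020), Thm. 3.14, Lemma 3.15, (F3) p. 103; H. Hironaka, J. Math. Kyoto Univ. 10
(1970) (13.1); M. Herrmann, S. Ikeda, U. Orbanz (1988) Cor. (21.11); B. Dietel (2015) (6.3.5) (ii).
-/

noncomputable section

-- single-conjunct summit: the doubled namespace component `ResolutionOfSingularities` is mandated
set_option linter.dupNamespace false

open CategoryTheory AlgebraicGeometry TopologicalSpace IsLocalRing MvPolynomial
open Literature.AlgebraicGeometry.Resolution Literature.AlgebraicGeometry.Resolution.HironakaScheme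
open Literature.RingTheory.HilbertSamuel Literature.RingTheory.MvPolynomial
open Literature.AlgebraicGeometry.CossartJannsenSaito2020
open Summit.ResolutionOfSingularities.ResolutionOfSingularities.Theorems.SigmaMaxModificationsCorridor3.Directrix214Sharp

namespace Summit.ResolutionOfSingularities.ResolutionOfSingularities.Theorems

namespace CampaignW42

universe u

section Schemes

variable {X X' : Scheme.{u}} [IsLocallyNoetherian X] {π : X' ⟶ X} {D : X.IdealSheafData}


/-- **CJS Thm. 3.14 for an arbitrary permissible centre under (F3) `e = ē`, normal-directrix form: `𝒯(J_D) ⊆ 𝔭_{x'}`.**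
`X` excellent, `D` permissible, `π : X' → X` a blow-up in `D`, `x' ∈ X'` over `x ∈ V(D)` NEAR to `x` at ANY level `N`
(`H^N_{X'}(x') = H^N_X(x)`) with **`e_x(X) = ē_x(X)`**; `g` a MINIMAL system of generators of `I_{D,x}`, `(t, u)` a chart datum at
`x'`. Then every linear form of the directrix space of the normal-cone fibre ideal `J_D = normalConeIdeal g` lies in the
homogeneous prime `𝔭_{x'} = chartPrime` of the point `x'` of `ℙ(N_{D,x})` — «`x' ∈ ℙ(Dir_x(X)/T_x(D))`». Fact-free, every
characteristic (F-split is the tree theorem `HerrmannIkedaOrbanz1988_cor_21_11_holds`; `e = ē` passes to `J_D` by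
`e(J_z) = e(J_D) + dim 𝒪_{D,x}` over `κ(x)` and over `κ(x)^{alg}`; then `𝒯(J_D) ⊆ √𝔉(J_D)` and `ū ∈ F(J_D)(κ(x'))`).
[cite: CossartJannsenSaito2020, Thm. 3.14, p. 103 (F3)] [cite: Hironaka1970NumericalCharacters, (13.1) p. 168] -/
theorem directrixSpace_normalConeIdeal_le_chartPrime_of_dirDim_eq_geomDirDim (hX : Scheme.IsExcellent X)
    (hperm : IdealSheafData.IsPermissible D) (hπ : IsBlowup π D) {N : ℕ}
    (x' : X') (hxD : π.base x' ∈ (D.support : Set X))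
    (he : Scheme.dirDim X (π.base x') = Scheme.geomDirDim X (π.base x'))
    (hnear : Scheme.hsFun X' N x' = Scheme.hsFun X N (π.base x'))
    {m : ℕ} (g : Fin m → X.presheaf.stalk (π.base x')) (hg : Ideal.span (Set.range g) = stalkIdeal D (π.base x'))
    (hm : (stalkIdeal D (π.base x')).spanFinrank = m)
    (t : X'.presheaf.stalk x') (ht : t ∈ nonZeroDivisors (X'.presheaf.stalk x'))
    (hmap : (stalkIdeal D (π.base x')).map (π.stalkMap x').hom = Ideal.span {t})
    (u : Fin m → X'.presheaf.stalk x') (hu : ∀ i, (π.stalkMap x').hom (g i) = u i * t) :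
    ∀ L ∈ directrixSpace (normalConeIdeal g),
      L ∈ Literature.RingTheory.HilbertSamuel.chartPrime (π.stalkMap x').hom u := by
  classical
  haveI : IsLocalHom (π.stalkMap x').hom := π.toLRSHom.prop x'
  letI algκ : Algebra (ResidueField (X.presheaf.stalk (π.base x'))) (ResidueField (X'.presheaf.stalk x')) :=
    (ResidueField.map (π.stalkMap x').hom).toAlgebra
  -- the permissible centre at `x`
  have hIperm : (stalkIdeal D (π.base x')).IsPermissible := hperm _ hxD
  haveI hreg : IsRegularLocalRing (X.presheaf.stalk (π.base x') ⧸ stalkIdeal D (π.base x')) := hIperm.isRegularLocalRing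
  have hmg : (Ideal.span (Set.range g)).spanFinrank = m := by rw [hg, hm]
  -- a lift `y` of a regular system of parameters of `𝒪_{X,x} ⧸ I`
  obtain ⟨s, hs⟩ : ∃ s : ℕ, (maximalIdeal (X.presheaf.stalk (π.base x') ⧸ stalkIdeal D (π.base x'))).spanFinrank = s :=
    ⟨_, rfl⟩
  have hdimI : ringKrullDim (X.presheaf.stalk (π.base x') ⧸ stalkIdeal D (π.base x')) = (s : WithBot ℕ∞) := by
    rw [← hs]; exact hreg.spanFinrank_maximalIdeal.symm
  obtain ⟨ybar, hybar⟩ := exists_span_range_eq_maximalIdeal (X.presheaf.stalk (π.base x') ⧸ stalkIdeal D (π.base x'))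
    (e := s) hs.le
  have hy' : ∀ i, ∃ yi : X.presheaf.stalk (π.base x'), Ideal.Quotient.mk (stalkIdeal D (π.base x')) yi = ybar i :=
    fun i => Ideal.Quotient.mk_surjective (ybar i)
  choose y hy using hy'
  have hz : Ideal.span (Set.range (Fin.append g y)) = maximalIdeal (X.presheaf.stalk (π.base x')) := by
    have hcomap : (maximalIdeal (X.presheaf.stalk (π.base x') ⧸ stalkIdeal D (π.base x'))).comap
        (Ideal.Quotient.mk (stalkIdeal D (π.base x'))) = maximalIdeal (X.presheaf.stalk (π.base x')) :=
      IsLocalRing.eq_maximalIdeal (Ideal.comap_isMaximal_of_surjective _ Ideal.Quotient.mk_surjective)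
    have hybar' : Ideal.span (Set.range ybar) = (Ideal.span (Set.range y)).map (Ideal.Quotient.mk (stalkIdeal D (π.base x'))) := by
      have hfun : ybar = (Ideal.Quotient.mk (stalkIdeal D (π.base x'))) ∘ y := funext fun i => (hy i).symm
      rw [Ideal.map_span, ← Set.range_comp, hfun]
    rw [Literature.AlgebraicGeometry.Resolution.range_fin_append, Ideal.span_union, hg, ← hcomap, ← hybar, hybar',
      Ideal.comap_map_of_surjective _ Ideal.Quotient.mk_surjective]
    rw [sup_comm]
    congr 1
    exact (Ideal.mk_ker (I := stalkIdeal D (π.base x'))).symm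
  -- F-split (tree theorem): `J_z = J_D · k[Z]`
  have hJz := HerrmannIkedaOrbanz1988_cor_21_11_holds (X.presheaf.stalk (π.base x')) (stalkIdeal D (π.base x')) m
    s g y hz hg hreg
    hIperm.isNormallyFlat hdimI
  have hE : (maximalIdeal (X.presheaf.stalk (π.base x'))).spanFinrank =
      m + s :=
    spanFinrank_maximalIdeal_eq_of_tangentConeIdeal_eq hmg hz hJz
  -- `e = ē` for `J_D`, over `K̄ = κ(x)^{alg}`
  have hdirDim : Scheme.dirDim X (π.base x') = directrixDim (tangentConeIdeal (Fin.append g y) hz) :=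
    dirDim_eq' (X.presheaf.stalk (π.base x')) hE (Fin.append g y) hz
  have hgeomA : Scheme.geomDirDim X (π.base x') = directrixDim ((tangentConeIdeal (Fin.append g y) hz).map
      (MvPolynomial.map (algebraMap (ResidueField (X.presheaf.stalk (π.base x')))
        (AlgebraicClosure (ResidueField (X.presheaf.stalk (π.base x'))))))) :=
    dirDimOver_eq' (X.presheaf.stalk (π.base x')) (AlgebraicClosure (ResidueField (X.presheaf.stalk (π.base x')))) hE
      (Fin.append g y) hz
  have heJD : directrixDim (normalConeIdeal g) = directrixDim ((normalConeIdeal g).map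
      (MvPolynomial.map (algebraMap (ResidueField (X.presheaf.stalk (π.base x')))
        (AlgebraicClosure (ResidueField (X.presheaf.stalk (π.base x'))))))) := by
    have h1 := directrixDim_map_rename_castAdd
      s (normalConeIdeal g)
    have h2 := directrixDim_map_rename_castAdd
      s
      ((normalConeIdeal g).map (MvPolynomial.map (algebraMap (ResidueField (X.presheaf.stalk (π.base x')))
        (AlgebraicClosure (ResidueField (X.presheaf.stalk (π.base x')))))))
    rw [← hJz, ← hdirDim] at h1
    rw [← map_map_rename_eq, ← hJz, ← hgeomA] at h2
    omega
  -- `𝒯(J_D) ⊆ √𝔉(J_D)` and `ū ∈ F(J_D)(κ(x'))`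
  intro L hL
  have hLrad : L ∈ (ridgeIdeal (normalConeIdeal g)).radical :=
    directrixSpace_le_radical_ridgeIdeal_of_directrixDim_map_eq (isHomogeneousIdeal_normalConeIdeal g)
      (AlgebraicClosure (ResidueField (X.presheaf.stalk (π.base x')))) heJD hL
  have hū := residue_mem_ridge_normalConeIdeal_of_isNearPoint hπ x' (hperm _ hxD)
    (hX.isUniversallyCatenaryRing_stalk _) (N := N) hnear g hg t ht hmap u hu
  have hLū := aeval_eq_zero_of_mem_ridge_of_mem_radical hū hLrad
  have hL1 : L.IsHomogeneous 1 := (mem_homogeneousSubmodule 1 L).mp (directrixSpace_le_one _ hL)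
  rw [mem_chartPrime_iff_of_isHomogeneous (π.stalkMap x').hom u hL1]
  exact hLū

/-- **CJS Thm. 3.14 for an arbitrary permissible centre under (F3) `e = ē`, NUMERICAL form: `dim 𝒪_{D,x} < e_x(X)`.**
`X` excellent and locally noetherian, `D` permissible, `π : X' → X` a blow-up in `D`, `x' ∈ X'` over `x ∈ V(D)` NEAR to `x`
at ANY level `N` (`H^N_{X'}(x') = H^N_X(x)`) and **`e_x(X) = ē_x(X)`**: then `dim 𝒪_{D,x} < e_x(X)`. This is the conclusion of
`Moving.Theorem314_geomDir` / `CossartJannsenSaito2020_thm_3_14` WITHOUT (F1)/(F1♯) and WITHOUT any named fact (res-type-001's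
counting over `directrixSpace_normalConeIdeal_le_chartPrime_of_dirDim_eq_geomDirDim`).
[cite: CossartJannsenSaito2020, Thm. 3.14, Lemma 3.15 (2), p. 103 (F3)] -/
theorem theorem314_numerical_of_dirDim_eq_geomDirDim (hX : Scheme.IsExcellent X)
    (hperm : IdealSheafData.IsPermissible D) (hπ : IsBlowup π D) {N : ℕ}
    (x' : X') (hxD : π.base x' ∈ (D.support : Set X))
    (he : Scheme.dirDim X (π.base x') = Scheme.geomDirDim X (π.base x'))
    (hnear : Scheme.hsFun X' N x' = Scheme.hsFun X N (π.base x')) :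
    ringKrullDim (X.presheaf.stalk (π.base x') ⧸ stalkIdeal D (π.base x')) < (Scheme.dirDim X (π.base x') : WithBot ℕ∞) := by
  classical
  set A := X.presheaf.stalk (π.base x') with hA
  set K := ResidueField A with hK
  set B := X'.presheaf.stalk x' with hB
  set φ : A →+* B := (π.stalkMap x').hom with hφ
  haveI : IsLocalHom φ := π.toLRSHom.prop x'
  -- the permissible centre at `x`
  set I : Ideal A := stalkIdeal D (π.base x') with hI
  have hIperm : I.IsPermissible := hperm _ hxD
  haveI hreg : IsRegularLocalRing (A ⧸ I) := hIperm.isRegularLocalRing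
  -- the chart of the exceptional divisor at `x'`
  obtain ⟨t, ht, hspan⟩ := hπ.isEffectiveCartier.exists_stalkIdeal_eq_span x'
  have hmap : I.map φ = Ideal.span {t} := by
    rw [← hspan, stalkIdeal_comap_eq_map_stalkMap]
  -- minimal generators of `I`; `μ(I) ≥ 1` since `I` lies in no minimal prime
  obtain ⟨g₀, hg₀⟩ := exists_fun_span_eq_of_fg (I := I) (IsNoetherian.noetherian I)
  have hmpos : 0 < I.spanFinrank := by
    by_contra h0
    have h0' : I.spanFinrank = 0 := by omega
    have hIbot : I = ⊥ := by
      rw [← hg₀, Ideal.span_eq_bot]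
      rintro _ ⟨i, rfl⟩
      exact Fin.elim0 (Fin.cast h0' i)
    obtain ⟨q, hq, -⟩ := Ideal.exists_minimalPrimes_le (I := (⊥ : Ideal A)) (J := maximalIdeal A) bot_le
    exact hIperm.not_le_of_mem_minimalPrimes hq (hIbot ▸ bot_le)
  obtain ⟨n, hn⟩ : ∃ n, I.spanFinrank = n + 1 := ⟨_, (Nat.succ_pred_eq_of_pos hmpos).symm⟩
  set g : Fin (n + 1) → A := g₀ ∘ Fin.cast hn.symm with hg
  have hgI : Ideal.span (Set.range g) = I := by
    have hsurj : Function.Surjective (Fin.cast hn.symm) := fun i => ⟨Fin.cast hn i, by simp⟩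
    rw [hg, hsurj.range_comp]
    exact hg₀
  have hm : (Ideal.span (Set.range g)).spanFinrank = n + 1 := by rw [hgI, hn]
  -- `π^♯(g_i) = u_i t`
  have hu : ∀ i, ∃ ui : B, φ (g i) = ui * t := by
    intro i
    have hmem : φ (g i) ∈ I.map φ := by
      refine Ideal.mem_map_of_mem φ ?_
      rw [← hgI]
      exact Ideal.subset_span ⟨i, rfl⟩
    rw [hmap, Ideal.mem_span_singleton'] at hmem
    obtain ⟨ui, hui⟩ := hmem
    exact ⟨ui, hui.symm⟩
  choose u hu using hu
  -- a lift `y` of a regular system of parameters of `A ⧸ I`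
  set s := (maximalIdeal (A ⧸ I)).spanFinrank with hs
  have hdimI : ringKrullDim (A ⧸ I) = (s : WithBot ℕ∞) := hreg.spanFinrank_maximalIdeal.symm
  obtain ⟨ybar, hybar⟩ := exists_span_range_eq_maximalIdeal (A ⧸ I) (e := s) le_rfl
  have hy' : ∀ i, ∃ yi : A, Ideal.Quotient.mk I yi = ybar i := fun i => Ideal.Quotient.mk_surjective (ybar i)
  choose y hy using hy'
  have hz : Ideal.span (Set.range (Fin.append g y)) = maximalIdeal A := by
    have hcomap : (maximalIdeal (A ⧸ I)).comap (Ideal.Quotient.mk I) = maximalIdeal A :=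
      IsLocalRing.eq_maximalIdeal
        (Ideal.comap_isMaximal_of_surjective _ Ideal.Quotient.mk_surjective)
    have hybar' : Ideal.span (Set.range ybar) = (Ideal.span (Set.range y)).map (Ideal.Quotient.mk I) := by
      have hfun : ybar = (Ideal.Quotient.mk I) ∘ y := funext fun i => (hy i).symm
      rw [Ideal.map_span, ← Set.range_comp, hfun]
    rw [Literature.AlgebraicGeometry.Resolution.range_fin_append, Ideal.span_union, hgI, ← hcomap, ← hybar, hybar',
      Ideal.comap_map_of_surjective _ Ideal.Quotient.mk_surjective]
    rw [sup_comm]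
    congr 1
    exact (Ideal.mk_ker (I := I)).symm
  -- F-split (tree theorem): `J_z = J_D · k[Z]`
  have hJz := HerrmannIkedaOrbanz1988_cor_21_11_holds A I (n + 1) s g y hz hgI hreg hIperm.isNormallyFlat hdimI
  -- the point `𝔭_{x'}` of `ℙ(N_{D,x})` misses a variable
  set JD := normalConeIdeal g with hJD
  set 𝔭 := Literature.RingTheory.HilbertSamuel.chartPrime φ u with h𝔭
  obtain ⟨i₀, hi₀⟩ := exists_X_not_mem_chartPrime_of_map_eq φ hgI ht hmap hu
  -- the core, fact-free under `e = ē`: `𝒯(J_D) ⊆ 𝔭_{x'}`, so `e(C_{X,D,x}) ≥ 1`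
  have hcore : ∀ L ∈ directrixSpace JD, L ∈ 𝔭 := fun L hL =>
    directrixSpace_normalConeIdeal_le_chartPrime_of_dirDim_eq_geomDirDim hX hperm hπ x' hxD he hnear g hgI hn t ht
      hmap u hu L hL
  have hone : 1 ≤ directrixDim JD :=
    one_le_directrixDim_of_not_mem ((mem_homogeneousSubmodule 1 _).mpr (isHomogeneous_X K i₀))
      fun h => hi₀ (hcore _ h)
  -- `e_x(X) = e(J_z) = e(J_D) + s ≥ 1 + s`
  have hE : (maximalIdeal A).spanFinrank = (n + 1) + s :=
    spanFinrank_maximalIdeal_eq_of_tangentConeIdeal_eq hm hz hJz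
  have hdirDim : Scheme.dirDim X (π.base x') = directrixDim (tangentConeIdeal (Fin.append g y) hz) :=
    dirDim_eq' A hE (Fin.append g y) hz
  have hes : s + 1 ≤ Scheme.dirDim X (π.base x') := by
    have h1 := directrixDim_add_le_directrixDim_map_rename s JD
    rw [← hJz, ← hdirDim] at h1
    omega
  have hlt : s < Scheme.dirDim X (π.base x') := by omega
  show ringKrullDim (A ⧸ I) < (Scheme.dirDim X (π.base x') : WithBot ℕ∞)
  rw [hdimI]
  exact_mod_cast hlt

end Schemes

end CampaignW42

end Summit.ResolutionOfSingularities.ResolutionOfSingularities.Theorems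

end
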